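import Summits.RiemannHypothesis.RiemannHypothesis.Theorems.SemilocalSoninNearVector
import Summits.RiemannHypothesis.RiemannHypothesis.Theorems.MotivicDoorSemilocalMollify
import Summits.RiemannHypothesis.RiemannHypothesis.Theorems.PfPersistenceGalerkinFormMellin
import HarnessLib

/-!
# The semilocal operator obligation: mollifying a bounded witness (Sonin side and moment conditions)

Cell `rh-explicit`, seat cc-s2-1 (HOME `run/shared/lean/pub/rh-explicit/`; lead ruling R5-1 — "cc-s2-1's mollification
lemma", task E6 of `HOME/cc-s2-3/CERT-PLAN.md` §7).  Companion of `SemilocalSoninNearVector` (the near-vector bridge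
`not_semilocalSoninIneqOn_of_near_vector`, which wants a SMOOTH test function `g`).

The archived certificates against `SemilocalSoninIneqOn 2 b` (`EXTREMALS/S2-sonin-refute-0549`) use a test function
`G` that is a polynomial piece on `[−b, b]` — bounded, measurable, vanishing off `[−b, b]`, continuous except at
`±b` — not a Weil test function.  As for the tree's Markov witnesses (`MotivicDoorSemilocalMollify`, seat cc-s2-2 /
lad-2), one passes to the mollifications `g_k = G ⋆ φ_k` (`φ_k = moll k`, support radius `1/(k+1)`).  This file
records, for a bounded measurable `G` vanishing off `[−b, b]` (NO parity assumption):

* `g_k` is a Weil test function supported in `[−(b + 1/(k+1)), b + 1/(k+1)]`, `|g_k| ≤ M`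
  (`isWeilTest_weilConv_moll_of_bdd`, `tsupport_weilConv_moll_subset_of_bdd`, `norm_weilConv_moll_le_of_bdd`);
* **moments are multiplicative**: `mulFourier (G ⋆ φ_k) s = mulFourier G s · mulFourier φ_k s`
  (`mulFourier_weilConv_moll_of_bdd`), so CC's conditions `f̂(i/2) = f̂(0) = 0` pass from `G` to every `g_k`;
* **`g_k → G` in `L¹`** when `G` is continuous a.e. (`tendsto_integral_norm_weilConv_moll_sub`; dominated convergence
  with the tree's pointwise lemma `IsMarkovWitness.tendsto_weilConv_moll_of_continuousAt`);
* hence the kernels `k_k = g_k ⋆ g̃_k → k_G = G ⋆ G̃` in `L¹` (`integral_norm_kernel_moll_sub_le`: `‖k_k − k_G‖₁ ≤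
  8(b+1)M‖g_k − G‖₁`) and **the Sonin term converges**: `⟨η | ϑ(T_p k_k) η⟩ → ⟨η | ϑ(T_p k_G) η⟩` for every
  `η ∈ L²(ℝ)` (`tendsto_soninTraceForm_twistKernel_moll`, via `norm_soninTraceForm_sub_kernel_le`).

Proof-only file (no definitions, no named facts); `integrable_weilReflect` is reused from the tree's
`PfPersistenceGalerkinFormMellin`. [folklore]
-/

set_option linter.dupNamespace false  -- the mandated namespace repeats `RiemannHypothesis`

noncomputable section

open MeasureTheory Complex Set Filter Topology
open scoped Real ComplexConjugate Convolution ENNReal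

namespace Summit.RiemannHypothesis.RiemannHypothesis

open Literature.NumberTheory.LFunctions Literature.NumberTheory.LFunctions.WeilContinuous
  Literature.NumberTheory.ConnesConsani2021
  Summit.RiemannHypothesis.RiemannHypothesis.Theorems.MotivicDoor.SemilocalMarkov

section BoundedWitness

variable {G : ℝ → ℂ} {b M : ℝ}

/-! ## A bounded measurable function vanishing off `[−b, b]` and its mollifications -/

/-- Such a `G` is integrable. [folklore] -/
theorem integrable_of_bdd (hGm : Measurable G) (hM : ∀ x, ‖G x‖ ≤ M) (hGb : ∀ x, b < |x| → G x = 0) :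
    Integrable G :=
  integrable_of_norm_le_of_eq_zero hGm.aestronglyMeasurable hM hGb

/-- Such a `G` has compact support. [folklore] -/
theorem hasCompactSupport_of_bdd (hGb : ∀ x, b < |x| → G x = 0) : HasCompactSupport G :=
  HasCompactSupport.intro (isCompact_Icc (a := -b) (b := b)) fun x hx => hGb x (lt_abs_of_not_mem_Icc hx)
/-- `0 ≤ M`. [folklore] -/
theorem bound_nonneg_of_bdd (hM : ∀ x, ‖G x‖ ≤ M) : 0 ≤ M := (norm_nonneg _).trans (hM 0)
/-- `g_k = G ⋆ φ_k` is a Weil test function. [folklore] -/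
theorem isWeilTest_weilConv_moll_of_bdd (hGm : Measurable G) (hM : ∀ x, ‖G x‖ ≤ M)
    (hGb : ∀ x, b < |x| → G x = 0) (k : ℕ) : IsWeilTest (weilConv G (moll k)) := by
  rw [weilConv_eq_convolution_real]
  exact ⟨(hasCompactSupport_moll k).contDiff_convolution_right (ContinuousLinearMap.mul ℝ ℂ)
      (integrable_of_bdd hGm hM hGb).locallyIntegrable (contDiff_moll k),
    (hasCompactSupport_of_bdd hGb).convolution (L := ContinuousLinearMap.mul ℝ ℂ) (hasCompactSupport_moll k)⟩

/-- `|g_k| ≤ M`. [folklore] -/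
theorem norm_weilConv_moll_le_of_bdd (hM : ∀ x, ‖G x‖ ≤ M) (k : ℕ) (x : ℝ) :
    ‖weilConv G (moll k) x‖ ≤ M := by
  rw [weilConv_apply]
  calc ‖∫ u, G u * moll k (x - u)‖ ≤ ∫ u, ‖G u * moll k (x - u)‖ := norm_integral_le_integral_norm _
    _ ≤ ∫ u, M * ‖moll k (x - u)‖ := by
        refine integral_mono_of_nonneg (Eventually.of_forall fun _ ↦ norm_nonneg _)
          (((integrable_norm_moll k).comp_sub_left x).const_mul M) (Eventually.of_forall fun u ↦ ?_)
        dsimp only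
        rw [norm_mul]
        exact mul_le_mul_of_nonneg_right (hM u) (norm_nonneg _)
    _ = M := by
        rw [integral_const_mul, integral_sub_left_eq_self (fun u ↦ ‖moll k u‖) volume x,
          integral_norm_moll k, mul_one]

/-- `g_k(x) = 0` for `|x| > b + 1/(k+1)`. [folklore] -/
theorem weilConv_moll_eq_zero_of_bdd (hGb : ∀ x, b < |x| → G x = 0) {k : ℕ} {x : ℝ}
    (hx : b + (bump k).rOut < |x|) : weilConv G (moll k) x = 0 := by
  rw [weilConv_apply]
  refine integral_eq_zero_of_ae (Eventually.of_forall fun u ↦ ?_)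
  simp only [Pi.zero_apply]
  rcases le_or_gt (bump k).rOut |x - u| with hu | hu
  · rw [moll_eq_zero hu, mul_zero]
  · have h2 : b < |u| := by
      have := abs_sub_abs_le_abs_sub x u
      linarith
    rw [hGb u h2, zero_mul]

/-- `g_k(x) = 0` for `|x| > b + 1`. [folklore] -/
theorem weilConv_moll_eq_zero_of_bdd_of_lt (hGb : ∀ x, b < |x| → G x = 0) {k : ℕ} {x : ℝ}
    (hx : b + 1 < |x|) : weilConv G (moll k) x = 0 :=
  weilConv_moll_eq_zero_of_bdd hGb (lt_of_le_of_lt (by linarith [bump_rOut_le_one k]) hx)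

/-- `tsupport g_k ⊆ [−(b + 1/(k+1)), b + 1/(k+1)]`. [folklore] -/
theorem tsupport_weilConv_moll_subset_of_bdd (hGb : ∀ x, b < |x| → G x = 0) (k : ℕ) :
    tsupport (weilConv G (moll k)) ⊆ Icc (-(b + (bump k).rOut)) (b + (bump k).rOut) := by
  refine closure_minimal (fun x hx ↦ ?_) isClosed_Icc
  rw [Function.mem_support] at hx
  by_contra h
  exact hx (weilConv_moll_eq_zero_of_bdd hGb (lt_abs_of_not_mem_Icc h))

/-! ## Moments are multiplicative under mollification -/

/-- `u ↦ G(u) e^{cu}` is integrable. [folklore] -/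
theorem integrable_mul_cexp_of_bdd (hGm : Measurable G) (hM : ∀ x, ‖G x‖ ≤ M)
    (hGb : ∀ x, b < |x| → G x = 0) (c : ℂ) : Integrable fun u : ℝ ↦ G u * cexp (c * u) := by
  have hM0 := bound_nonneg_of_bdd hM
  refine integrable_of_norm_le_of_eq_zero (C := M * Real.exp (‖c‖ * b)) (R := b)
    (hGm.mul (by fun_prop : Continuous fun u : ℝ ↦ cexp (c * u)).measurable).aestronglyMeasurable
    (fun u ↦ ?_) (fun u hu ↦ by rw [hGb u hu, zero_mul])
  by_cases hu : b < |u|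
  · rw [hGb u hu, zero_mul, norm_zero]
    exact mul_nonneg hM0 (Real.exp_pos _).le
  · rw [not_lt] at hu
    rw [norm_mul, Complex.norm_exp]
    refine mul_le_mul (hM u) (Real.exp_le_exp.2 ?_) (Real.exp_pos _).le hM0
    have h1 : (c * (u : ℂ)).re ≤ ‖c * (u : ℂ)‖ := Complex.re_le_norm _
    rw [norm_mul, Complex.norm_real, Real.norm_eq_abs] at h1
    exact h1.trans (mul_le_mul_of_nonneg_left hu (norm_nonneg _))

/-- **`(G ⋆ φ_k)^(s) = Ĝ(s)·φ̂_k(s)`** in the tree's `weilMellin` normalisation (Fubini / Mathlib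
`integral_convolution`), for bounded measurable `G` vanishing off `[−b, b]`. [folklore] -/
theorem weilMellin_weilConv_moll_of_bdd (hGm : Measurable G) (hM : ∀ x, ‖G x‖ ≤ M)
    (hGb : ∀ x, b < |x| → G x = 0) (k : ℕ) (s : ℂ) :
    weilMellin (weilConv G (moll k)) s = weilMellin G s * weilMellin (moll k) s := by
  set c : ℂ := s - 1 / 2 with hc
  set G' : ℝ → ℂ := fun u ↦ G u * cexp (c * u) with hG'
  set H : ℝ → ℂ := fun u ↦ moll k u * cexp (c * u) with hH
  have hGi : Integrable G' := integrable_mul_cexp_of_bdd hGm hM hGb c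
  have hHi : Integrable H :=
    ((continuous_moll k).mul (by fun_prop)).integrable_of_hasCompactSupport
      (hasCompactSupport_moll k).mul_right
  have key : ∀ t : ℝ, weilConv G (moll k) t * cexp (c * t) = (G' ⋆[ContinuousLinearMap.mul ℂ ℂ] H) t := by
    intro t
    rw [weilConv_apply, convolution_def, ← integral_mul_const]
    congr 1 with u
    simp only [hG', hH, ContinuousLinearMap.mul_apply']
    have he : cexp (c * t) = cexp (c * u) * cexp (c * ((t - u : ℝ) : ℂ)) := by
      rw [← Complex.exp_add]
      push_cast
      ring_nf
    rw [he]
    ring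
  have hL : weilMellin (weilConv G (moll k)) s = ∫ t : ℝ, (G' ⋆[ContinuousLinearMap.mul ℂ ℂ] H) t := by
    unfold weilMellin
    exact integral_congr_ae (Eventually.of_forall fun t ↦ key t)
  rw [hL, integral_convolution (ContinuousLinearMap.mul ℂ ℂ) hGi hHi, ContinuousLinearMap.mul_apply']
  rfl

/-- **CC's moment transform is multiplicative under mollification**:
`mulFourier (G ⋆ φ_k) s = mulFourier G s · mulFourier φ_k s`. [folklore] -/
theorem mulFourier_weilConv_moll_of_bdd (hGm : Measurable G) (hM : ∀ x, ‖G x‖ ≤ M)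
    (hGb : ∀ x, b < |x| → G x = 0) (k : ℕ) (s : ℂ) :
    mulFourier (weilConv G (moll k)) s = mulFourier G s * mulFourier (moll k) s := by
  rw [mulFourier_eq_weilMellin, mulFourier_eq_weilMellin, mulFourier_eq_weilMellin,
    weilMellin_weilConv_moll_of_bdd hGm hM hGb]

/-- If `G` satisfies a CC moment condition `f̂(s) = 0`, so does every `g_k`. [folklore] -/
theorem mulFourier_weilConv_moll_eq_zero (hGm : Measurable G) (hM : ∀ x, ‖G x‖ ≤ M)
    (hGb : ∀ x, b < |x| → G x = 0) {s : ℂ} (hs : mulFourier G s = 0) (k : ℕ) :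
    mulFourier (weilConv G (moll k)) s = 0 := by
  rw [mulFourier_weilConv_moll_of_bdd hGm hM hGb, hs, zero_mul]

/-! ## `g_k → G` in `L¹` -/

/-- **`∫ ‖g_k − G‖ → 0`** for a bounded measurable `G` vanishing off `[−b, b]` that is continuous almost everywhere
(dominated convergence: `|g_k − G| ≤ 2M·1_{[−b−1, b+1]}`, pointwise convergence at continuity points by the tree's
`IsMarkovWitness.tendsto_weilConv_moll_of_continuousAt`). [folklore] -/
theorem tendsto_integral_norm_weilConv_moll_sub (hGm : Measurable G) (hM : ∀ x, ‖G x‖ ≤ M)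
    (hGb : ∀ x, b < |x| → G x = 0) (hGc : ∀ᵐ x : ℝ, ContinuousAt G x) :
    Tendsto (fun k : ℕ ↦ ∫ x, ‖weilConv G (moll k) x - G x‖) atTop (𝓝 0) := by
  have hM0 := bound_nonneg_of_bdd hM
  set bound : ℝ → ℝ := (Icc (-(b + 1)) (b + 1)).indicator fun _ ↦ 2 * M with hbound
  have hbi : Integrable bound :=
    ((continuous_const).integrableOn_Icc).integrable_indicator measurableSet_Icc
  have hmeas : ∀ k : ℕ, AEStronglyMeasurable (fun x ↦ ‖weilConv G (moll k) x - G x‖) volume := fun k ↦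
    (((isWeilTest_weilConv_moll_of_bdd hGm hM hGb k).1.continuous.measurable.sub hGm).norm).aestronglyMeasurable
  have hdom : ∀ k : ℕ, ∀ᵐ x : ℝ, ‖‖weilConv G (moll k) x - G x‖‖ ≤ bound x := fun k ↦
    Eventually.of_forall fun x ↦ by
      rw [norm_norm]
      by_cases hx : x ∈ Icc (-(b + 1)) (b + 1)
      · rw [hbound, indicator_of_mem hx]
        calc ‖weilConv G (moll k) x - G x‖ ≤ ‖weilConv G (moll k) x‖ + ‖G x‖ := norm_sub_le _ _
          _ ≤ M + M := add_le_add (norm_weilConv_moll_le_of_bdd hM k x) (hM x)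
          _ = 2 * M := by ring
      · rw [hbound, indicator_of_notMem hx]
        have hx' : b + 1 < |x| := lt_abs_of_not_mem_Icc hx
        rw [weilConv_moll_eq_zero_of_bdd_of_lt hGb hx', hGb x (by linarith [hx']), sub_zero, norm_zero]
  have hlim : ∀ᵐ x : ℝ, Tendsto (fun k : ℕ ↦ ‖weilConv G (moll k) x - G x‖) atTop (𝓝 0) := by
    filter_upwards [hGc] with x hx
    have h := IsMarkovWitness.tendsto_weilConv_moll_of_continuousAt hGm hM hx
    rw [← tendsto_sub_nhds_zero_iff] at h
    exact tendsto_norm_zero.comp h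
  have h := tendsto_integral_of_dominated_convergence bound hmeas hbi hdom hlim
  rwa [integral_zero] at h

/-! ## The kernels `k_k = g_k ⋆ g̃_k` converge in `L¹` -/

/-- Linearity/size of the additive convolution in the FIRST argument against a bounded measurable `h`:
`‖(f₁ ⋆ h)(t) − (f₂ ⋆ h)(t)‖ ≤ C · ∫‖f₁ − f₂‖`. [folklore] -/
theorem norm_weilConv_sub_weilConv_left_le {f₁ f₂ h : ℝ → ℂ} {C : ℝ} (hf₁ : Integrable f₁) (hf₂ : Integrable f₂)
    (hhm : Measurable h) (hC : ∀ x, ‖h x‖ ≤ C) (t : ℝ) :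
    ‖weilConv f₁ h t - weilConv f₂ h t‖ ≤ C * ∫ u, ‖f₁ u - f₂ u‖ := by
  have hC0 : 0 ≤ C := (norm_nonneg _).trans (hC 0)
  have hmeas : AEStronglyMeasurable (fun u : ℝ ↦ h (t - u)) volume :=
    (hhm.comp (measurable_const.sub measurable_id)).aestronglyMeasurable
  have i1 : Integrable fun u : ℝ ↦ f₁ u * h (t - u) :=
    hf₁.mul_bdd hmeas (Eventually.of_forall fun u ↦ hC (t - u))
  have i2 : Integrable fun u : ℝ ↦ f₂ u * h (t - u) :=
    hf₂.mul_bdd hmeas (Eventually.of_forall fun u ↦ hC (t - u))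
  rw [weilConv_apply, weilConv_apply, ← integral_sub i1 i2]
  have hpt : ∀ u, ‖f₁ u * h (t - u) - f₂ u * h (t - u)‖ ≤ ‖f₁ u - f₂ u‖ * C := fun u ↦ by
    rw [← sub_mul, norm_mul]
    exact mul_le_mul_of_nonneg_left (hC _) (norm_nonneg _)
  calc ‖∫ u, (f₁ u * h (t - u) - f₂ u * h (t - u))‖
      ≤ ∫ u, ‖f₁ u * h (t - u) - f₂ u * h (t - u)‖ := norm_integral_le_integral_norm _
    _ ≤ ∫ u, ‖f₁ u - f₂ u‖ * C :=
        integral_mono_of_nonneg (Eventually.of_forall fun _ ↦ norm_nonneg _) ((hf₁.sub hf₂).norm.mul_const _)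
          (Eventually.of_forall hpt)
    _ = C * ∫ u, ‖f₁ u - f₂ u‖ := by rw [integral_mul_const, mul_comm]

/-- The same in the SECOND argument against a bounded measurable `f`:
`‖(f ⋆ h₁)(t) − (f ⋆ h₂)(t)‖ ≤ C · ∫‖h₁ − h₂‖`. [folklore] -/
theorem norm_weilConv_sub_weilConv_right_le {f h₁ h₂ : ℝ → ℂ} {C : ℝ} (hfm : Measurable f) (hC : ∀ x, ‖f x‖ ≤ C)
    (hh₁ : Integrable h₁) (hh₂ : Integrable h₂) (t : ℝ) :
    ‖weilConv f h₁ t - weilConv f h₂ t‖ ≤ C * ∫ u, ‖h₁ u - h₂ u‖ := by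
  have hC0 : 0 ≤ C := (norm_nonneg _).trans (hC 0)
  have j1 : Integrable fun u : ℝ ↦ h₁ (t - u) := hh₁.comp_sub_left t
  have j2 : Integrable fun u : ℝ ↦ h₂ (t - u) := hh₂.comp_sub_left t
  have i1 : Integrable fun u : ℝ ↦ f u * h₁ (t - u) :=
    j1.bdd_mul hfm.aestronglyMeasurable (Eventually.of_forall hC)
  have i2 : Integrable fun u : ℝ ↦ f u * h₂ (t - u) :=
    j2.bdd_mul hfm.aestronglyMeasurable (Eventually.of_forall hC)
  rw [weilConv_apply, weilConv_apply, ← integral_sub i1 i2]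
  have hpt : ∀ u, ‖f u * h₁ (t - u) - f u * h₂ (t - u)‖ ≤ C * ‖h₁ (t - u) - h₂ (t - u)‖ := fun u ↦ by
    rw [← mul_sub, norm_mul]
    exact mul_le_mul_of_nonneg_right (hC _) (norm_nonneg _)
  calc ‖∫ u, (f u * h₁ (t - u) - f u * h₂ (t - u))‖
      ≤ ∫ u, ‖f u * h₁ (t - u) - f u * h₂ (t - u)‖ := norm_integral_le_integral_norm _
    _ ≤ ∫ u, C * ‖h₁ (t - u) - h₂ (t - u)‖ :=
        integral_mono_of_nonneg (Eventually.of_forall fun _ ↦ norm_nonneg _) ((j1.sub j2).norm.const_mul _)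
          (Eventually.of_forall hpt)
    _ = C * ∫ u, ‖h₁ u - h₂ u‖ := by
        rw [integral_const_mul, integral_sub_left_eq_self (fun u ↦ ‖h₁ u - h₂ u‖) volume t]

/-- `∫‖g̃₁ − g̃₂‖ = ∫‖g₁ − g₂‖` for the involution `g̃(t) = conj g(−t)`. [folklore] -/
theorem integral_norm_weilReflect_sub (g₁ g₂ : ℝ → ℂ) :
    ∫ u, ‖weilReflect g₁ u - weilReflect g₂ u‖ = ∫ u, ‖g₁ u - g₂ u‖ := by
  have h : ∀ u, ‖weilReflect g₁ u - weilReflect g₂ u‖ = ‖g₁ (-u) - g₂ (-u)‖ := fun u ↦ by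
    unfold weilReflect
    rw [← map_sub, Complex.norm_conj]
  simp_rw [h]
  exact integral_neg_eq_self (fun u ↦ ‖g₁ u - g₂ u‖) volume

/-- `g̃` is measurable if `g` is. [folklore] -/
theorem measurable_weilReflect {g : ℝ → ℂ} (hg : Measurable g) : Measurable (weilReflect g) :=
  (Complex.continuous_conj.measurable.comp (hg.comp measurable_neg))
/-- Support of a convolution of functions vanishing off `[−R, R]`: `(f ⋆ h)(t) = 0` for `|t| > 2R`. [folklore] -/
theorem weilConv_eq_zero_of_support {f h : ℝ → ℂ} {R : ℝ} (hf : ∀ x, R < |x| → f x = 0)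
    (hh : ∀ x, R < |x| → h x = 0) {t : ℝ} (ht : 2 * R < |t|) : weilConv f h t = 0 := by
  rw [weilConv_apply]
  refine integral_eq_zero_of_ae (Eventually.of_forall fun u ↦ ?_)
  simp only [Pi.zero_apply]
  by_cases hu : R < |u|
  · rw [hf u hu, zero_mul]
  · rw [not_lt] at hu
    have h1 : R < |t - u| := by
      have := abs_sub_abs_le_abs_sub t u
      linarith
    rw [hh (t - u) h1, mul_zero]

/-- **`‖k_k − k_G‖_{L¹} ≤ 8(b+1)M · ‖g_k − G‖_{L¹}`** for the kernels `k_k = g_k ⋆ g̃_k`, `k_G = G ⋆ G̃`: both vanish off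
`[−2(b+1), 2(b+1)]` and differ pointwise by at most `2M‖g_k − G‖_{L¹}`. [folklore] -/
theorem integral_norm_kernel_moll_sub_le (hGm : Measurable G) (hM : ∀ x, ‖G x‖ ≤ M)
    (hGb : ∀ x, b < |x| → G x = 0) (hb : 0 ≤ b) (k : ℕ) :
    ∫ t, ‖weilConv (weilConv G (moll k)) (weilReflect (weilConv G (moll k))) t - weilConv G (weilReflect G) t‖
      ≤ 8 * (b + 1) * M * ∫ x, ‖weilConv G (moll k) x - G x‖ := by
  set g := weilConv G (moll k) with hg
  have hM0 := bound_nonneg_of_bdd hM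
  have hGi : Integrable G := integrable_of_bdd hGm hM hGb
  have hgt : IsWeilTest g := isWeilTest_weilConv_moll_of_bdd hGm hM hGb k
  have hgm : Measurable g := hgt.1.continuous.measurable
  have hgi : Integrable g := hgt.1.continuous.integrable_of_hasCompactSupport hgt.2
  have hgM : ∀ x, ‖g x‖ ≤ M := norm_weilConv_moll_le_of_bdd hM k
  have hgb : ∀ x, b + 1 < |x| → g x = 0 := fun x hx ↦ weilConv_moll_eq_zero_of_bdd_of_lt hGb hx
  have hGb' : ∀ x, b + 1 < |x| → G x = 0 := fun x hx ↦ hGb x (by linarith)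
  -- pointwise bound
  set δ : ℝ := ∫ x, ‖g x - G x‖ with hδ
  have hδ0 : 0 ≤ δ := integral_nonneg fun _ ↦ norm_nonneg _
  have hpt : ∀ t, ‖weilConv g (weilReflect g) t - weilConv G (weilReflect G) t‖ ≤ 2 * M * δ := fun t ↦ by
    have h1 : ‖weilConv g (weilReflect g) t - weilConv G (weilReflect g) t‖ ≤ M * δ :=
      norm_weilConv_sub_weilConv_left_le hgi hGi (measurable_weilReflect hgm)
        (fun x ↦ by rw [show ‖weilReflect g x‖ = ‖g (-x)‖ by simp [weilReflect]]; exact hgM _) t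
    have h2 : ‖weilConv G (weilReflect g) t - weilConv G (weilReflect G) t‖ ≤ M * δ := by
      have h := norm_weilConv_sub_weilConv_right_le hGm hM (Theorems.PfPersistence.integrable_weilReflect hgi)
        (Theorems.PfPersistence.integrable_weilReflect hGi) t
      rwa [integral_norm_weilReflect_sub] at h
    calc _ = ‖(weilConv g (weilReflect g) t - weilConv G (weilReflect g) t)
          + (weilConv G (weilReflect g) t - weilConv G (weilReflect G) t)‖ := by rw [sub_add_sub_cancel]
      _ ≤ M * δ + M * δ := (norm_add_le _ _).trans (add_le_add h1 h2)
      _ = 2 * M * δ := by ring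
  -- support
  have hsupp : ∀ t, 2 * (b + 1) < |t| →
      weilConv g (weilReflect g) t - weilConv G (weilReflect G) t = 0 := fun t ht ↦ by
    have hrg : ∀ x, b + 1 < |x| → weilReflect g x = 0 := fun x hx ↦ by
      unfold weilReflect; rw [hgb (-x) (by rwa [abs_neg]), map_zero]
    have hrG : ∀ x, b + 1 < |x| → weilReflect G x = 0 := fun x hx ↦ by
      unfold weilReflect; rw [hGb' (-x) (by rwa [abs_neg]), map_zero]
    rw [weilConv_eq_zero_of_support hgb hrg ht, weilConv_eq_zero_of_support hGb' hrG ht, sub_zero]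
  -- integrate the pointwise bound over the support
  set F : ℝ → ℂ := fun t ↦ weilConv g (weilReflect g) t - weilConv G (weilReflect G) t with hF
  have hle : ∀ t, ‖F t‖ ≤ (Icc (-(2 * (b + 1))) (2 * (b + 1))).indicator (fun _ ↦ 2 * M * δ) t := fun t ↦ by
    by_cases ht : t ∈ Icc (-(2 * (b + 1))) (2 * (b + 1))
    · rw [indicator_of_mem ht]; exact hpt t
    · rw [indicator_of_notMem ht, hF]
      simp only
      rw [hsupp t (lt_abs_of_not_mem_Icc ht), norm_zero]
  have hind : Integrable ((Icc (-(2 * (b + 1))) (2 * (b + 1))).indicator fun _ : ℝ ↦ 2 * M * δ) :=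
    ((continuous_const).integrableOn_Icc).integrable_indicator measurableSet_Icc
  calc ∫ t, ‖F t‖ ≤ ∫ t, (Icc (-(2 * (b + 1))) (2 * (b + 1))).indicator (fun _ ↦ 2 * M * δ) t :=
        integral_mono_of_nonneg (Eventually.of_forall fun _ ↦ norm_nonneg _) hind (Eventually.of_forall hle)
    _ = 8 * (b + 1) * M * δ := by
        rw [integral_indicator measurableSet_Icc, setIntegral_const, smul_eq_mul, Measure.real, Real.volume_Icc,
          ENNReal.toReal_ofReal (by linarith)]
        ring

/-! ## The Sonin term converges under mollification -/

variable (p : ℕ)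

/-- **Sonin-side mollification** (task E6): for a bounded measurable `G` vanishing off `[−b, b]`, continuous a.e.,
and any `η ∈ L²(ℝ)`, the diagonal Sonin coefficient of the twisted kernels of the mollifications converges:
`⟨η | ϑ(T_p (g_k ⋆ g̃_k)) η⟩ → ⟨η | ϑ(T_p (G ⋆ G̃)) η⟩`, `g_k = G ⋆ φ_k`. [folklore] -/
theorem tendsto_soninTraceForm_twistKernel_moll (hGm : Measurable G) (hM : ∀ x, ‖G x‖ ≤ M)
    (hGb : ∀ x, b < |x| → G x = 0) (hb : 0 ≤ b) (hGc : ∀ᵐ x : ℝ, ContinuousAt G x)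
    (η : Lp ℂ 2 (volume : Measure ℝ)) :
    Tendsto (fun k : ℕ ↦ soninTraceForm (twistKernel p
        (weilConv (weilConv G (moll k)) (weilReflect (weilConv G (moll k))))) (η : ℝ → ℂ)) atTop
      (𝓝 (soninTraceForm (twistKernel p (weilConv G (weilReflect G))) (η : ℝ → ℂ))) := by
  have hM0 := bound_nonneg_of_bdd hM
  have hGi : Integrable G := integrable_of_bdd hGm hM hGb
  -- integrability of the two kernels
  have hkG : Integrable (weilConv G (weilReflect G)) := by
    unfold weilConv
    exact hGi.integrable_convolution (ContinuousLinearMap.mul ℂ ℂ) (Theorems.PfPersistence.integrable_weilReflect hGi)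
  have hkk : ∀ k : ℕ, Integrable (weilConv (weilConv G (moll k)) (weilReflect (weilConv G (moll k)))) := fun k ↦
    integrable_weilConv_weilReflect (isWeilTest_weilConv_moll_of_bdd hGm hM hGb k)
  -- the estimate
  set c : ℝ := (1 + (p : ℝ)⁻¹ + 2 * Real.exp (-(Real.log p / 2))) with hc
  have hc0 : 0 ≤ c := by positivity
  have hbound : ∀ k : ℕ, ‖soninTraceForm (twistKernel p
        (weilConv (weilConv G (moll k)) (weilReflect (weilConv G (moll k))))) (η : ℝ → ℂ)
      - soninTraceForm (twistKernel p (weilConv G (weilReflect G))) (η : ℝ → ℂ)‖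
      ≤ c * (8 * (b + 1) * M) * ‖η‖ ^ 2 * ∫ x, ‖weilConv G (moll k) x - G x‖ := fun k ↦ by
    have h1 := norm_soninTraceForm_sub_kernel_le (integrable_twistKernel p (hkk k))
      (integrable_twistKernel p hkG) η
    have h2 : ∫ τ, ‖twistKernel p (weilConv (weilConv G (moll k)) (weilReflect (weilConv G (moll k)))) τ
        - twistKernel p (weilConv G (weilReflect G)) τ‖
        ≤ c * ∫ τ, ‖weilConv (weilConv G (moll k)) (weilReflect (weilConv G (moll k))) τ
          - weilConv G (weilReflect G) τ‖ := by
      have hlin : ∀ τ, twistKernel p (weilConv (weilConv G (moll k)) (weilReflect (weilConv G (moll k)))) τ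
          - twistKernel p (weilConv G (weilReflect G)) τ
          = twistKernel p (weilConv (weilConv G (moll k)) (weilReflect (weilConv G (moll k)))
              - weilConv G (weilReflect G)) τ := fun τ ↦ by
        simp only [twistKernel, Pi.sub_apply]; ring
      simp_rw [hlin]
      exact integral_norm_twistKernel_le p ((hkk k).sub hkG)
    have h3 := integral_norm_kernel_moll_sub_le hGm hM hGb hb k
    calc _ ≤ _ := h1
      _ ≤ (c * (8 * (b + 1) * M * ∫ x, ‖weilConv G (moll k) x - G x‖)) * ‖η‖ ^ 2 := by
          gcongr
          exact h2.trans (mul_le_mul_of_nonneg_left h3 hc0)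
      _ = c * (8 * (b + 1) * M) * ‖η‖ ^ 2 * ∫ x, ‖weilConv G (moll k) x - G x‖ := by ring
  -- squeeze
  have hlim : Tendsto (fun k : ℕ ↦ c * (8 * (b + 1) * M) * ‖η‖ ^ 2 * ∫ x, ‖weilConv G (moll k) x - G x‖)
      atTop (𝓝 0) := by
    have h := (tendsto_integral_norm_weilConv_moll_sub hGm hM hGb hGc).const_mul (c * (8 * (b + 1) * M) * ‖η‖ ^ 2)
    rwa [mul_zero] at h
  rw [tendsto_iff_norm_sub_tendsto_zero]
  exact squeeze_zero (fun _ ↦ norm_nonneg _) hbound hlim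

end BoundedWitness

end Summit.RiemannHypothesis.RiemannHypothesis
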